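import Summits.ValiantsHypothesis.ValiantsHypothesis.Theorems.BarrierLeverSuccinctHittingSetsForVPGeneratorEquivalence
import Summits.ValiantsHypothesis.ValiantsHypothesis.Theorems.BarrierLeverSuccinctHittingSetsForVPUniversalJointSize

/-!
# Crux `BarrierLever.SuccinctHittingSetsForVP` (stmt-ValiantsHypothesis-14610) — UNIVERSAL JOINTNESS
# (FSV Lemma 13): `Q6 ⇒` a JOINTLY `VP`-succinct generator fooling the level-1 distinguishers

The cell planner `valiant-natproofs-p1`'s WANTED W1 (`UniversalJointness`, HOME/p1/Chain.lean §4 /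
MEMO §6), PROVED: if `SuccinctHittingSetsForVP ℂ` (FSV Question 6, the crux) then for some `b, n₀` and
every `n ≥ n₀` there is a polynomial map `G : degLEMonomials n → ℂ[y_1..y_q]` which is JOINTLY
succinct — ONE polynomial `Γ ∈ ℂ[x ⊕ y]` of circuit size `≤ n^b` with `Γ(x, a) = Σ_m G_m(a) x^m` of
degree `≤ n` for every seed `a` (spelled out; this is VERBATIM the body of
`Literature.Barriers.ValiantsHypothesis.JointlySuccinct ℂ n q b G` of `AlgebraicNaturalProofsPlanting.lean`,
the notion refuted there for all planted design generators under permanent hardness) — and is a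
hitting set generator for `Distinguishers ℂ n 1` (spelled out: the body of the door file's
`IsHittingSetGenerator`). The two named forms follow by `Iff.rfl` once those modules are built; this
file imports only built modules so that it can be verified now.
So the "jointly succinct generator" reading of the open arrow loses nothing: modulo the crux it is
equivalent to the per-seed one (p1's `generator_iff_krstForVP`).

* `exists_jointGenerator` — the universal generator of `…GeneratorEquivalence.exists_generator`
  (Raz's universal circuit-graphs, one per degree `k ≤ n`, plus a constant coordinate), with its
  "into" half upgraded from per-seed to JOINT: the witness is `Γ = y_{c₀} + Σ_k OUT_k(x, y_k)` built
  from `…UniversalJointSize.jointOut` (`complexity_jointOut_le_poly`, `aeval_labels_jointOut`).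
* `universalJointness` — the statement above, with `b = 5 b₁ + 23` from the level-1 exponent `b₁`
  of the hypothesis.

(The planner's own gen-3 sketch HOME/p1/Chain3.lean §1–§3 proves the same statement independently,
with an explicit generator `gen n b`; this file is the tree landing, built on the landed
`…UniversalJointSize`.) Unconditional implication; does NOT close the item. WHAT THIS IS NOT: no
generator is exhibited unconditionally; nothing about hardness.

References: [ForbesShpilkaVolk2018] Lemma 13, Question 6; [Raz2010] Prop. 2.8, 3.3.
-/

-- layout Summits/ValiantsHypothesis/ValiantsHypothesis forces the duplicated namespace component
set_option linter.dupNamespace false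

noncomputable section

namespace Summit.ValiantsHypothesis.ValiantsHypothesis.Theorems.BarrierLever.SuccinctHittingSetsForVP

open Literature.Barriers.ValiantsHypothesis Literature.Computability.AlgebraicComplexity MvPolynomial
open Generator UniversalJointSize Summit.ValiantsHypothesis.ValiantsHypothesis.Theorems.BarrierLever.SuccinctHittingSetsForVP.UniversalJointSize

namespace UniversalJoint

/-- **The universal generator, jointly succinct.** For `b` and `n ≥ 1`: a polynomial map `G` on
`p ≤ 9376 (n+3)^(5b+21)` parameters whose image contains `coeff(SmallCircuits ℂ n b)`, together
with ONE polynomial `Γ ∈ ℂ[x ⊕ y]` of size `≤ 21876 (n+3)^(5b+21) + 1` such that for every seed `a`,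
`Γ(x, a)` has degree `≤ n` and coefficient vector `G(a)`.
[cite: ForbesShpilkaVolk2018, Lemma 13; Raz2010, Prop. 3.3 (p. 158)] -/
theorem exists_jointGenerator (b n : ℕ) (hn : 1 ≤ n) :
    ∃ (p : ℕ) (G : degLEMonomials n → MvPolynomial (Fin p) ℂ),
      p ≤ 9376 * (n + 3) ^ (5 * b + 21) ∧
      (∀ f ∈ SmallCircuits ℂ n b, ∃ y : Fin p → ℂ, ∀ m,
        eval y (G m) = coeff (m : Fin n →₀ ℕ) f) ∧
      ∃ Γ : MvPolynomial (Fin n ⊕ Fin p) ℂ, complexity Γ ≤ 21876 * (n + 3) ^ (5 * b + 21) + 1 ∧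
        ∀ y : Fin p → ℂ, (aeval (Sum.elim X fun j => C (y j)) Γ).totalDegree ≤ n ∧
          ∀ m : degLEMonomials n,
            coeff (m : Fin n →₀ ℕ) (aeval (Sum.elim X fun j => C (y j)) Γ) = eval y (G m) := by
  classical
  -- parameters: one universal circuit-graph per degree `k : Fin (n + 1)` (unused for `k = 0`)
  set s := (n + 1) * (n ^ b + n + 2) with hs
  set W := 4 * s * (n + 1) ^ 2 with hW
  let L : Fin (n + 1) → Type := fun k => RazUniversal.Lab (Fin n) (k : ℕ) W
  let P := Unit ⊕ (Σ k : Fin (n + 1), L k)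
  let lvl : degLEMonomials n → Fin (n + 1) := fun m =>
    ⟨(m : Fin n →₀ ℕ).degree, Nat.lt_succ_of_le m.2⟩
  let G₀ : degLEMonomials n → MvPolynomial P ℂ := fun m =>
    if (m : Fin n →₀ ℕ).degree = 0 then X (Sum.inl ())
    else rename (fun l : L (lvl m) => (Sum.inr ⟨lvl m, l⟩ : P))
      (RazUniversal.uCoeff ℂ (Fin n) (lvl m : ℕ) W (m : Fin n →₀ ℕ))
  let e := Fintype.equivFin P
  obtain ⟨hb1, hb2⟩ := bounds n b
  have hlab : ∀ k : Fin (n + 1), Fintype.card (L k) ≤ 9375 * (n + 3) ^ (5 * b + 20) := by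
    intro k
    refine (RazUniversal.card_lab_le (Fin n) k W).trans (le_trans ?_ hb1)
    rw [Fintype.card_fin]
    have hk : (k : ℕ) ≤ n := Nat.lt_succ_iff.mp k.isLt
    gcongr
  -- the joint witness: `Γ = y_{c₀} + Σ_k OUT_k(x, y_k)` in the variables `Fin n ⊕ Fin p`
  let ι : ∀ k : Fin (n + 1), Fin n ⊕ L k → Fin n ⊕ Fin (Fintype.card P) := fun k =>
    Sum.map id fun l => e (Sum.inr ⟨k, l⟩)
  let J : Fin (n + 1) → MvPolynomial (Fin n ⊕ Fin (Fintype.card P)) ℂ := fun k =>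
    if 1 ≤ (k : ℕ) then rename (ι k) (jointOut (Fin n) (k : ℕ) W) else 0
  let Γ : MvPolynomial (Fin n ⊕ Fin (Fintype.card P)) ℂ := X (Sum.inr (e (Sum.inl ()))) + ∑ k, J k
  refine ⟨Fintype.card P, fun m => rename e (G₀ m), ?_, ?_, Γ, ?_, ?_⟩
  · -- parameter count
    have hP : Fintype.card P = 1 + ∑ k : Fin (n + 1), Fintype.card (L k) := by
      simp [P, Fintype.card_sum, Fintype.card_sigma]
    rw [hP]
    have h1 : 1 ≤ (n + 3) ^ (5 * b + 21) := Nat.one_le_pow _ _ (by omega)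
    calc 1 + ∑ k : Fin (n + 1), Fintype.card (L k)
        ≤ 1 + ∑ _k : Fin (n + 1), 9375 * (n + 3) ^ (5 * b + 20) := by
          gcongr with k; exact hlab k
      _ = 1 + (n + 1) * (9375 * (n + 3) ^ (5 * b + 20)) := by simp
      _ ≤ 1 + (n + 3) * (9375 * (n + 3) ^ (5 * b + 20)) := by gcongr; omega
      _ = 1 + 9375 * (n + 3) ^ (5 * b + 21) := by ring
      _ ≤ 9376 * (n + 3) ^ (5 * b + 21) := by omega
  · -- onto the class `b`
    intro f hf
    have hlabels : ∀ k : Fin (n + 1), ∃ y : L k → ℂ, 1 ≤ (k : ℕ) →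
        ∀ e', eval y (RazUniversal.uCoeff ℂ (Fin n) (k : ℕ) W e') =
          coeff e' (homogeneousComponent (k : ℕ) f) := by
      intro k
      by_cases hk : 1 ≤ (k : ℕ)
      · have hkn : (k : ℕ) ≤ n := Nat.lt_succ_iff.mp k.isLt
        have hg : (homogeneousComponent (k : ℕ) f).IsHomogeneous (k : ℕ) :=
          homogeneousComponent_isHomogeneous _ _
        have hgc : complexity (homogeneousComponent (k : ℕ) f) ≤ s := by
          have h1 := Summit.ValiantsHypothesis.ValiantsHypothesis.Theorems.DivisionGapZeroOneTransfer.SqrtCheap.complexity_homogeneousComponent_le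
            f hf.1 (k : ℕ)
          rw [Fintype.card_fin] at h1
          exact h1.trans (Nat.mul_le_mul_left _ (by have := hf.2; omega))
        have hN : 4 * s * ((k : ℕ) + 1) ^ 2 ≤ W := by rw [hW]; gcongr
        obtain ⟨y, hy⟩ := RazUniversal.exists_eval_uCoeff_eq_coeff (R := ℂ) (σ := Fin n)
          (r := (k : ℕ)) (N := W) (s := s) hk hN hg hgc
        exact ⟨y, fun _ => hy⟩
      · exact ⟨fun _ => 0, fun h => absurd h hk⟩
    choose y hy using hlabels
    let Y : P → ℂ := Sum.elim (fun _ => coeff 0 f) (fun kl => y kl.1 kl.2)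
    refine ⟨Y ∘ e.symm, fun m => ?_⟩
    rw [eval_rename, Function.comp_assoc, Equiv.symm_comp_self, Function.comp_id]
    simp only [G₀]
    split_ifs with h0
    · rw [eval_X]
      have hm0 : (m : Fin n →₀ ℕ) = 0 := (Finsupp.degree_eq_zero_iff _).mp h0
      simp [Y, hm0]
    · rw [eval_rename]
      have hk1 : 1 ≤ ((lvl m : Fin (n + 1)) : ℕ) := Nat.one_le_iff_ne_zero.mpr h0
      have hcomp : Y ∘ (fun l : L (lvl m) => (Sum.inr ⟨lvl m, l⟩ : P)) = y (lvl m) := by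
        funext l; simp [Y]
      rw [hcomp, hy (lvl m) hk1]
      simp only [lvl]
      rw [coeff_homogeneousComponent, if_pos rfl]
  · -- size of the joint witness
    have hJc : ∀ k : Fin (n + 1), complexity (J k) ≤ 21875 * (n + 3) ^ (5 * b + 20) := by
      intro k
      simp only [J]
      split_ifs
      · refine (complexity_rename_le_holds' _ _).trans ?_
        refine (complexity_jointOut_le_poly (r := (k : ℕ)) (N := W)).trans (le_trans ?_ hb2)
        have hk : (k : ℕ) ≤ n := Nat.lt_succ_iff.mp k.isLt
        gcongr
      · rw [← C_0, complexity_C_holds]; exact Nat.zero_le _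
    have h1 : 1 ≤ (n + 3) ^ (5 * b + 20) := Nat.one_le_pow _ _ (by omega)
    calc complexity Γ
        ≤ complexity (X (Sum.inr (e (Sum.inl ()))) : MvPolynomial (Fin n ⊕ Fin (Fintype.card P)) ℂ) +
            complexity (∑ k, J k) + 1 := complexity_add_le_holds _ _
      _ ≤ 0 + (∑ k, complexity (J k) + (Finset.univ : Finset (Fin (n + 1))).card) + 1 := by
          rw [complexity_X_holds]
          gcongr
          exact complexity_finset_sum_le _ _
      _ ≤ 0 + (∑ _k : Fin (n + 1), 21875 * (n + 3) ^ (5 * b + 20) +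
            (Finset.univ : Finset (Fin (n + 1))).card) + 1 := by
          gcongr with k; exact hJc k
      _ = (n + 1) * (21875 * (n + 3) ^ (5 * b + 20)) + (n + 1) + 1 := by simp
      _ ≤ (n + 3) * (21875 * (n + 3) ^ (5 * b + 20)) + (n + 3) * (n + 3) ^ (5 * b + 20) + 1 := by
          nlinarith
      _ = 21876 * (n + 3) ^ (5 * b + 21) + 1 := by ring
  · -- the seed specialisations of the joint witness
    intro y'
    let Y : P → ℂ := y' ∘ e
    let g : Fin (n + 1) → MvPolynomial (Fin n) ℂ := fun k =>
      if 1 ≤ (k : ℕ) then RazUniversal.outVal (fun l : L k => Y (Sum.inr ⟨k, l⟩)) else 0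
    have hghom : ∀ k : Fin (n + 1), (g k).IsHomogeneous (k : ℕ) := by
      intro k
      simp only [g]
      split_ifs
      · exact UniversalSize.isHomogeneous_outVal _
      · exact isHomogeneous_zero _ _ _
    -- `Γ(x, y') = y'_{c₀} + Σ_k OUT_k(y'_k)`
    have hJspec : ∀ k : Fin (n + 1), aeval (Sum.elim X fun j => C (y' j)) (J k) = g k := by
      intro k
      simp only [J, g]
      split_ifs with hk
      · rw [aeval_rename]
        have hfun : ((Sum.elim X fun j => C (y' j)) ∘ ι k :
            Fin n ⊕ L k → MvPolynomial (Fin n) ℂ) =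
            Sum.elim X fun l => C (Y (Sum.inr ⟨k, l⟩)) := by
          funext v
          rcases v with t | l <;> rfl
        rw [hfun]
        exact aeval_labels_jointOut _
      · exact map_zero _
    have hspec : aeval (Sum.elim X fun j => C (y' j)) Γ = C (Y (Sum.inl ())) + ∑ k, g k := by
      simp only [Γ]
      rw [map_add, map_sum]
      congr 1
      · rw [aeval_X]
        rfl
      · exact Finset.sum_congr rfl fun k _ => hJspec k
    rw [hspec]
    refine ⟨?_, fun m => ?_⟩
    · -- degree
      refine (totalDegree_add _ _).trans (max_le (by rw [totalDegree_C]; exact Nat.zero_le _) ?_)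
      refine totalDegree_finsetSum_le fun k _ => (hghom k).totalDegree_le.trans ?_
      exact Nat.lt_succ_iff.mp k.isLt
    · -- coefficients
      rw [eval_rename]
      change coeff (m : Fin n →₀ ℕ) (C (Y (Sum.inl ())) + ∑ k, g k) = eval Y (G₀ m)
      rw [coeff_add, coeff_sum, coeff_C]
      simp only [G₀]
      -- only the summand `k = deg m` survives
      have hsum : ∑ k : Fin (n + 1), coeff (m : Fin n →₀ ℕ) (g k) =
          coeff (m : Fin n →₀ ℕ) (g (lvl m)) := by
        refine Finset.sum_eq_single (lvl m) (fun k _ hk => ?_) (fun h => absurd (Finset.mem_univ _) h)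
        refine (hghom k).coeff_eq_zero ?_
        intro hdeg
        exact hk (Fin.ext (by simp only [lvl]; exact hdeg.symm))
      rw [hsum]
      by_cases h0 : (m : Fin n →₀ ℕ).degree = 0
      · have hm0 : (m : Fin n →₀ ℕ) = 0 := (Finsupp.degree_eq_zero_iff _).mp h0
        rw [if_pos h0, if_pos hm0.symm, eval_X]
        have hlt : ¬ (1 ≤ ((lvl m : Fin (n + 1)) : ℕ)) := by simp only [lvl]; omega
        have : g (lvl m) = 0 := by simp only [g]; rw [if_neg hlt]
        rw [this, coeff_zero, add_zero]
      · have hm0 : (0 : Fin n →₀ ℕ) ≠ (m : Fin n →₀ ℕ) := by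
          intro h; apply h0; rw [← h]; simp
        rw [if_neg h0, if_neg hm0, zero_add, eval_rename]
        have hk1 : 1 ≤ ((lvl m : Fin (n + 1)) : ℕ) := Nat.one_le_iff_ne_zero.mpr h0
        have hg : g (lvl m) = RazUniversal.outVal (fun l : L (lvl m) => Y (Sum.inr ⟨lvl m, l⟩)) := by
          simp only [g]; rw [if_pos hk1]
        rw [hg, RazUniversal.coeff_outVal]
        rfl

/-- Arithmetic: `21876 (n+3)^(5b+21) + 1 ≤ n^(5b+23)` once `n ≥ 21876 · 2^(5b+21) + 1`. [folklore] -/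
theorem size_le_pow (b n : ℕ) (hn : 21876 * 2 ^ (5 * b + 21) + 1 ≤ n) :
    21876 * (n + 3) ^ (5 * b + 21) + 1 ≤ n ^ (5 * b + 23) := by
  have h2pow : 1 ≤ 2 ^ (5 * b + 21) := Nat.one_le_two_pow
  have h3 : n + 3 ≤ 2 * n := by omega
  have h1 : (n + 3) ^ (5 * b + 21) ≤ 2 ^ (5 * b + 21) * n ^ (5 * b + 21) := by
    rw [← mul_pow]; exact Nat.pow_le_pow_left h3 _
  have hne : 1 ≤ n ^ (5 * b + 21) := Nat.one_le_pow _ _ (by omega)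
  calc 21876 * (n + 3) ^ (5 * b + 21) + 1
      ≤ 21876 * (2 ^ (5 * b + 21) * n ^ (5 * b + 21)) + n ^ (5 * b + 21) := by gcongr
    _ = (21876 * 2 ^ (5 * b + 21) + 1) * n ^ (5 * b + 21) := by ring
    _ ≤ n * n ^ (5 * b + 21) := Nat.mul_le_mul_right _ hn
    _ = n ^ (5 * b + 22) := by ring
    _ ≤ n ^ (5 * b + 23) := Nat.pow_le_pow_right (by omega) (by omega)

/-- **Universal jointness (FSV Lemma 13; planner p1's WANTED W1 `UniversalJointness`), PROVED:**
if `SuccinctHittingSetsForVP ℂ` then for some `b, n₀` and all `n ≥ n₀` there is a JOINTLY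
`SmallCircuits`-succinct polynomial map (the body of `JointlySuccinct ℂ n q b G`: one circuit of
size `≤ n^b` in `x ⊕ y` specialising to `Σ_m G_m(a) x^m` of degree `≤ n` at every seed) that is a
hitting set generator for the level-`1` distinguishers (the body of `IsHittingSetGenerator`). (The universal generator of the class `b₁` given by the
hypothesis at level `1`; `b = 5 b₁ + 23`.) [cite: ForbesShpilkaVolk2018, Lemma 13] -/
theorem universalJointness (hQ : SuccinctHittingSetsForVP ℂ) :
    ∃ b n₀ : ℕ, ∀ n : ℕ, n₀ ≤ n → ∃ (q : ℕ) (G : degLEMonomials n → MvPolynomial (Fin q) ℂ),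
      (∃ Γ : MvPolynomial (Fin n ⊕ Fin q) ℂ, complexity Γ ≤ n ^ b ∧
        ∀ a : Fin q → ℂ, (aeval (Sum.elim X fun j => C (a j)) Γ).totalDegree ≤ n ∧
          ∀ m : degLEMonomials n,
            coeff (m : Fin n →₀ ℕ) (aeval (Sum.elim X fun j => C (a j)) Γ) = eval a (G m)) ∧
      ∀ D ∈ Distinguishers ℂ n 1, D ≠ 0 → bind₁ G D ≠ 0 := by
  obtain ⟨b₁, n₁, h⟩ := hQ 1
  refine ⟨5 * b₁ + 23, max n₁ (21876 * 2 ^ (5 * b₁ + 21) + 1), fun n hn => ?_⟩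
  have hn₁ : n₁ ≤ n := (le_max_left _ _).trans hn
  have hnT : 21876 * 2 ^ (5 * b₁ + 21) + 1 ≤ n := (le_max_right _ _).trans hn
  obtain ⟨p, G, -, honto, Γ, hΓc, hΓ⟩ := exists_jointGenerator b₁ n (by omega)
  refine ⟨p, G, ⟨Γ, hΓc.trans (size_le_pow b₁ n hnT), hΓ⟩, ?_⟩
  -- hitting: a distinguisher that is nonzero at the coefficient vector of a class member is
  -- nonzero at the corresponding value of the (onto) generator
  intro D hD hD0 hann
  obtain ⟨f, hf, hfD⟩ := h n hn₁ D hD hD0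
  obtain ⟨y, hy⟩ := honto f hf
  apply hfD
  have hout : (fun m => eval y (G m)) = coeffVector (degLEMonomials n) f := by
    funext m
    rw [coeffVector_apply, hy m]
  have hev : eval y (bind₁ G D) = eval (fun m => eval y (G m)) D := eval₂Hom_bind₁ _ _ _ _
  rw [← hout, ← hev, hann, map_zero]

end UniversalJoint

end Summit.ValiantsHypothesis.ValiantsHypothesis.Theorems.BarrierLever.SuccinctHittingSetsForVP

end
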